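import Literature.Geometry.Lorentzian.CoordTensorNorm
import Literature.Geometry.Lorentzian.CoordCurvatureNormEvolution
import Literature.Geometry.Lorentzian.CoordRicciCovariantIter
import HarnessLib

/-!
# Time-dependent covariant tensor fields in coordinates: `∂_t ∇T`, `∂_t tr T`, `∂_t |T|²`

Fourth layer of the rank-generic coordinate tensor calculus, towards Shi's derivative estimates
(Topping 2006, Thm. 3.3.1). For a smooth one-parameter family of metric components
`G : ℝ → E → (E →L E →L ℝ)` on `V × S` (`IsMetricFamilyOn G S V`, `CoordMetricVariation.lean`) and
time-dependent component fields `T : ℝ → E → (α → ι) → ℝ`: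

* `TSmoothFamOn T V S` (joint smoothness on `V × S`), `tder T S t` (time derivative of the
  components within `S`), with the closure properties under `∇`, `⊗`, relabelling, traces,
  the Laplacian and contractions (§1.2.3 of Topping: all these quantities are smooth on
  space-time);
* `chrDot` — `∂_t Γ^m_{ji} = bᵐ(Π_t(b_j,b_i))` (`varChrAt`), and **`hasDerivWithinAt_tcov`**:
  `∂_t (∇T)_{jI} = (∇ ∂_tT)_{jI} − Σ_a Σ_m ∂_tΓ^m_{jI_a} T_{I[a↦m]}` (Topping (2.3.3):
  `(∂_t∇ − ∇∂_t) A = A * ∇h`);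
* **`hasDerivWithinAt_ttr`**, **`hasDerivWithinAt_tinner`** — `∂_t` of traces and contractions
  (the inverse metric contributes `∂_t g^{jk}`);
* under the Ricci flow `∂_t G = −2 Ric` (hypothesis `hfl`): `∂_t g^{jk} = 2 Ric^{jk}` and
  **`hasDerivWithinAt_tnormSq_ricciFlow`**:
  `∂_t |T|² = 2⟨∂_tT, T⟩ + 2 Σ_a ⟨ricSlot_a T, T⟩`, with
  `(ricSlot_a T)_I = Σ_{m,c} g^{mc} Ric(b_c, b_{I_a}) T_{I[a↦m]}` (Topping, proof of Prop. 3.2.10: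
  the terms `R^{ij} g^{kl} … R_{ikac} R_{jlbd}`).

Everything is proved; no definition of `Prop` type.

## References

* P. Topping, *Lectures on the Ricci flow*, LMS Lecture Note Series 325, CUP 2006, §1.2.3,
  §2.3 ((2.3.3)), Prop. 2.3.1, Prop. 3.2.10 (proof), §3.3 ((3.3.3)). [Topping2006]
* B. O'Neill, *Semi-Riemannian geometry with applications to relativity*, Academic Press 1983,
  Ch. 2, Prop. 2.13; Ch. 3, Prop. 3.13. [ONeill1983]
-/

noncomputable section

set_option maxSynthPendingDepth 3

open Set Filter ContinuousLinearMap Module Function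
open scoped Topology ContDiff

namespace Literature.Geometry.Lorentzian

namespace MetricCoord

variable {E : Type*} [NormedAddCommGroup E] [NormedSpace ℝ E] {ι : Type*}

/-! ### Smooth families of component fields and their time derivative -/

section Fam

variable {α β : Type*}

/-- The time derivative of the components, within `S`: `(∂_t T)_I(x) = d/ds T_s(x)_I`.
[cite: Topping2006, §2.3] -/
def tder (T : ℝ → E → (α → ι) → ℝ) (S : Set ℝ) (t : ℝ) : E → (α → ι) → ℝ :=
  fun x I ↦ derivWithin (fun s ↦ T s x I) S t

variable {T : ℝ → E → (α → ι) → ℝ} {S : Set ℝ} {V : Set E} {x : E} {t : ℝ}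

omit [NormedAddCommGroup E] [NormedSpace ℝ E] in
/-- Unfolding lemma for `tder`. [cite: Topping2006, §2.3] -/
theorem tder_apply (T : ℝ → E → (α → ι) → ℝ) (S : Set ℝ) (t : ℝ) (x : E) (I : α → ι) :
    tder T S t x I = derivWithin (fun s ↦ T s x I) S t := rfl

/-- The slices of a smooth family are smooth. [cite: Topping2006, §1.2.3] -/
theorem TSmoothFamOn.slice (hT : TSmoothFamOn T V S) (ht : t ∈ S) : TSmoothOn (T t) V := by
  intro I
  have hmap : ContDiffOn ℝ ∞ (fun y : E ↦ (y, t)) V := (contDiff_id.prodMk contDiff_const).contDiffOn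
  exact (hT I).comp hmap fun y hy ↦ ⟨hy, ht⟩

/-- The components are differentiable in time within `S`, with derivative `tder`. [folklore] -/
theorem TSmoothFamOn.hasDerivWithinAt (hT : TSmoothFamOn T V S) (hx : x ∈ V) (ht : t ∈ S) (I : α → ι) :
    HasDerivWithinAt (fun s ↦ T s x I) (tder T S t x I) S t := by
  have h := hasDerivWithinAt_tslice ((hT I).differentiableOn (by simp)) hx ht
  exact h.differentiableWithinAt.hasDerivWithinAt

/-- `tder` of a smooth family is a smooth family. [cite: Topping2006, §1.2.3] -/
theorem TSmoothFamOn.tder (hT : TSmoothFamOn T V S) (hV : IsOpen V) (hS : UniqueDiffOn ℝ S) :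
    TSmoothFamOn (fun s ↦ tder T S s) V S := by
  intro I
  have hQ : UniqueDiffOn ℝ (V ×ˢ S) := UniqueDiffOn.prod hV.uniqueDiffOn hS
  have hD : ContDiffOn ℝ ∞ (fderivWithin ℝ (fun p : E × ℝ ↦ T p.2 p.1 I) (V ×ˢ S)) (V ×ˢ S) :=
    (hT I).fderivWithin hQ (by simp)
  have hD' : ContDiffOn ℝ ∞
      (fun q : E × ℝ ↦ fderivWithin ℝ (fun p : E × ℝ ↦ T p.2 p.1 I) (V ×ˢ S) q ((0 : E), (1 : ℝ))) (V ×ˢ S) :=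
    hD.clm_apply contDiffOn_const
  refine hD'.congr fun q hq ↦ ?_
  exact (hasDerivWithinAt_tslice ((hT I).differentiableOn (by simp)) hq.1 hq.2).derivWithin (hS q.2 hq.2)

/-- Sums of smooth families. [folklore] -/
theorem TSmoothFamOn.add {T' : ℝ → E → (α → ι) → ℝ} (hT : TSmoothFamOn T V S) (hT' : TSmoothFamOn T' V S) :
    TSmoothFamOn (fun s ↦ T s + T' s) V S :=
  fun I ↦ (hT I).add (hT' I)

/-- Differences of smooth families. [folklore] -/
theorem TSmoothFamOn.sub {T' : ℝ → E → (α → ι) → ℝ} (hT : TSmoothFamOn T V S) (hT' : TSmoothFamOn T' V S) :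
    TSmoothFamOn (fun s ↦ T s - T' s) V S :=
  fun I ↦ (hT I).sub (hT' I)

/-- Scalar multiples of smooth families. [folklore] -/
theorem TSmoothFamOn.smul (c : ℝ) (hT : TSmoothFamOn T V S) : TSmoothFamOn (fun s ↦ c • T s) V S :=
  fun I ↦ contDiffOn_const.mul (hT I)

/-- Negatives of smooth families. [folklore] -/
theorem TSmoothFamOn.neg (hT : TSmoothFamOn T V S) : TSmoothFamOn (fun s ↦ -T s) V S :=
  fun I ↦ (hT I).neg

/-- Finite sums of smooth families. [folklore] -/
theorem TSmoothFamOn.sum {κ : Type*} (s : Finset κ) {F : κ → ℝ → E → (α → ι) → ℝ}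
    (hF : ∀ c ∈ s, TSmoothFamOn (F c) V S) : TSmoothFamOn (fun t ↦ ∑ c ∈ s, F c t) V S := by
  intro I
  have : (fun p : E × ℝ ↦ (∑ c ∈ s, F c p.2) p.1 I) = fun p ↦ ∑ c ∈ s, F c p.2 p.1 I := by
    funext p; simp [Finset.sum_apply]
  rw [this]
  exact ContDiffOn.sum fun c hc ↦ hF c hc I

/-- Tensor products of smooth families. [folklore] -/
theorem TSmoothFamOn.tprod {T' : ℝ → E → (β → ι) → ℝ} (hT : TSmoothFamOn T V S) (hT' : TSmoothFamOn T' V S) :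
    TSmoothFamOn (fun s ↦ tprod (T s) (T' s)) V S :=
  fun _ ↦ (hT _).mul (hT' _)

/-- Families with the same components on `V × S`. [folklore] -/
theorem TSmoothFamOn.congr {T' : ℝ → E → (α → ι) → ℝ} (hT : TSmoothFamOn T V S)
    (h : ∀ s ∈ S, ∀ y ∈ V, ∀ I, T' s y I = T s y I) : TSmoothFamOn T' V S :=
  fun I ↦ (hT I).congr fun p hp ↦ h p.2 hp.2 p.1 hp.1 I

omit [NormedAddCommGroup E] [NormedSpace ℝ E] in
/-- `tder` commutes with relabelling. [folklore] -/
theorem tder_treindex (e : α ≃ β) (T : ℝ → E → (α → ι) → ℝ) (S : Set ℝ) (t : ℝ) :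
    tder (fun s ↦ treindex e (T s)) S t = treindex e (tder T S t) := rfl

/-- The `x`-directional derivatives of the components of a smooth family form a smooth family.
[folklore] -/
theorem TSmoothFamOn.fderiv_apply (hT : TSmoothFamOn T V S) (hV : IsOpen V) (hS : UniqueDiffOn ℝ S)
    (I : α → ι) (v : E) :
    ContDiffOn ℝ ∞ (fun p : E × ℝ ↦ fderiv ℝ (fun y ↦ T p.2 y I) p.1 v) (V ×ˢ S) :=
  (contDiffOn_fderiv_slice (F := fun p : E × ℝ ↦ T p.2 p.1 I) hV hS (hT I)).clm_apply contDiffOn_const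

end Fam

/-! ### Families built from the metric -/

section MetricFam

variable [Fintype ι] {G : ℝ → E → E →L[ℝ] E →L[ℝ] ℝ} {S : Set ℝ} {V : Set E} {x : E} {t : ℝ}
  (b : Basis ι ℝ E) {α : Type*} [FiniteDimensional ℝ E] [CompleteSpace E]

/-- `∂_t Γ^m_{ji} = bᵐ(Π_t(b_j, b_i))`, the components of the variation of the Christoffel map
(`varChrAt`). [cite: Topping2006, Prop. 2.3.1] -/
def chrDot (G : ℝ → E → E →L[ℝ] E →L[ℝ] ℝ) (S : Set ℝ) (b : Basis ι ℝ E) (t : ℝ) (x : E)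
    (j i m : ι) : ℝ :=
  b.coord m (varChrAt G S t x (b j) (b i))

omit [Fintype ι] in
/-- The Christoffel symbols of the family are differentiable in time within `S`, with derivative
`chrDot`. [cite: Topping2006, Prop. 2.3.1] -/
theorem IsMetricFamilyOn.hasDerivWithinAt_chrCoef (hG : IsMetricFamilyOn G S V) (hx : x ∈ V) (ht : t ∈ S)
    (j i m : ι) :
    HasDerivWithinAt (fun s ↦ chrCoef (G s) b x j i m) (chrDot G S b t x j i m) S t := by
  have h1 := ((hG.hasDerivWithinAt_chrAt hx ht).clm_apply (hasDerivWithinAt_const t S (b j)))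
  simp only [map_zero, add_zero] at h1
  have h2 := h1.clm_apply (hasDerivWithinAt_const t S (b i))
  simp only [map_zero, add_zero] at h2
  have h3 := (coordCLM b m).hasFDerivAt.comp_hasDerivWithinAt t h2
  simpa [chrCoef, chrDot, Function.comp_def] using h3

omit [Fintype ι] in
/-- The inverse metric coefficients of the family are jointly `C^∞` (a local copy of
`contDiffOn_ginv_family` of `CoordEnergyEvolution.lean`, not imported here). [folklore] -/
private theorem IsMetricFamilyOn.contDiffOn_ginv_family' (hG : IsMetricFamilyOn G S V) (i j : ι) :
    ContDiffOn ℝ ∞ (fun p : E × ℝ ↦ ginv (G p.2) b p.1 i j) (V ×ˢ S) :=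
  (coordCLM b i).contDiff.comp_contDiffOn (hG.contDiffOn_sharpAt_family.clm_apply contDiffOn_const)

variable {T : ℝ → E → (α → ι) → ℝ}

/-- The trace of a smooth family is a smooth family. [folklore] -/
theorem IsMetricFamilyOn.tsmoothFamOn_ttr (hG : IsMetricFamilyOn G S V)
    {T : ℝ → E → (Option (Option α) → ι) → ℝ} (hT : TSmoothFamOn T V S) :
    TSmoothFamOn (fun s ↦ ttr (G s) b (T s)) V S := by
  intro I
  simp only [ttr_apply]
  exact ContDiffOn.sum fun j _ ↦ ContDiffOn.sum fun k _ ↦ (hG.contDiffOn_ginv_family' b j k).mul (hT _)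

/-- The Laplacian of a smooth family is a smooth family. [cite: Topping2006, §1.2.3] -/
theorem IsMetricFamilyOn.tsmoothFamOn_tlap [Fintype α] [DecidableEq α] (hG : IsMetricFamilyOn G S V)
    (hT : TSmoothFamOn T V S) : TSmoothFamOn (fun s ↦ tlap (G s) b (T s)) V S :=
  hG.tsmoothFamOn_ttr b (hG.tsmoothFamOn_tcov b (hG.tsmoothFamOn_tcov b hT))

omit [Fintype ι] in
/-- `Π_a g^{I_a J_a}` of the family is jointly `C^∞`. [folklore] -/
theorem IsMetricFamilyOn.contDiffOn_prod_ginv_family [Fintype α] (hG : IsMetricFamilyOn G S V) (I J : α → ι) :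
    ContDiffOn ℝ ∞ (fun p : E × ℝ ↦ ∏ a, ginv (G p.2) b p.1 (I a) (J a)) (V ×ˢ S) :=
  contDiffOn_prod fun _ _ ↦ hG.contDiffOn_ginv_family' b _ _

/-- The full contraction of two smooth families is jointly `C^∞` on `V × S`. [cite: Topping2006, §1.2.3] -/
theorem IsMetricFamilyOn.contDiffOn_tinner_family [Fintype α] [DecidableEq α] (hG : IsMetricFamilyOn G S V)
    {T T' : ℝ → E → (α → ι) → ℝ} (hT : TSmoothFamOn T V S) (hT' : TSmoothFamOn T' V S) :
    ContDiffOn ℝ ∞ (fun p : E × ℝ ↦ tinner (G p.2) b (T p.2) (T' p.2) p.1) (V ×ˢ S) := by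
  simp only [tinner_apply]
  exact ContDiffOn.sum fun I _ ↦ ContDiffOn.sum fun J _ ↦
    (hG.contDiffOn_prod_ginv_family b I J).mul ((hT I).mul (hT' J))

/-- `|T|²` of a smooth family is jointly `C^∞` on `V × S`. [cite: Topping2006, §1.2.3] -/
theorem IsMetricFamilyOn.contDiffOn_tnormSq_family [Fintype α] [DecidableEq α] (hG : IsMetricFamilyOn G S V)
    (hT : TSmoothFamOn T V S) :
    ContDiffOn ℝ ∞ (fun p : E × ℝ ↦ tnormSq (G p.2) b (T p.2) p.1) (V ×ˢ S) :=
  hG.contDiffOn_tinner_family b hT hT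

omit [Fintype ι] [FiniteDimensional ℝ E] in
/-- The curvature components of the family form a smooth family. [cite: Topping2006, §1.2.3] -/
theorem IsMetricFamilyOn.tsmoothFamOn_rm4 (hG : IsMetricFamilyOn G S V) : TSmoothFamOn (fun s ↦ rm4 (G s) b) V S :=
  fun _ ↦ (hG.contDiffOn.clm_apply ((hG.contDiffOn_riemAt_family _ _).clm_apply contDiffOn_const)).clm_apply
    contDiffOn_const

end MetricFam

/-! ### Time derivatives of `∇T`, `tr T` and `⟨S, T⟩` -/

section TimeDeriv

variable [Fintype ι] {G : ℝ → E → E →L[ℝ] E →L[ℝ] ℝ} {S : Set ℝ} {V : Set E} {x : E} {t : ℝ}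
  (b : Basis ι ℝ E) {α : Type*} [Fintype α] [DecidableEq α] [FiniteDimensional ℝ E] [CompleteSpace E]
  {T : ℝ → E → (α → ι) → ℝ}

/-- **`∂_t (∇T)_{jI} = (∇ ∂_t T)_{jI} − Σ_a Σ_m ∂_tΓ^m_{jI_a} T_{I[a↦m]}`** — Topping's commutator
`(∂_t∇ − ∇∂_t)A = A * ∇h` ((2.3.3)) in components (mixed partials commute; `∂_tΓ = Π`).
[cite: Topping2006, §2.3, (2.3.3)] -/
theorem IsMetricFamilyOn.hasDerivWithinAt_tcov (hG : IsMetricFamilyOn G S V) (hT : TSmoothFamOn T V S)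
    (hx : x ∈ V) (ht : t ∈ S) (J : Option α → ι) :
    HasDerivWithinAt (fun s ↦ tcov (G s) b (T s) x J)
      (tcov (G t) b (tder T S t) x J
        - ∑ a, ∑ m, chrDot G S b t x (J none) (J (some a)) m * T t x (update (J ∘ some) a m)) S t := by
  have hV := hG.isOpen ht
  -- mixed partials for the component `T_{J ∘ some}`
  have h1 : HasDerivWithinAt (fun s ↦ fderiv ℝ (fun y ↦ T s y (J ∘ some)) x (b (J none)))
      (fderiv ℝ (fun y ↦ tder T S t y (J ∘ some)) x (b (J none))) S t := by
    have h := hasDerivWithinAt_fderiv_slice (F := fun p : E × ℝ ↦ T p.2 p.1 (J ∘ some)) hV hG.uniqueDiffOn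
      (hT _) hx ht (hG.subset_closure_interior ht)
    have h' := h.clm_apply (hasDerivWithinAt_const t S (b (J none)))
    simp only [map_zero, add_zero] at h'
    exact h'
  -- the Christoffel sum
  have h2 : ∀ a m, HasDerivWithinAt (fun s ↦ chrCoef (G s) b x (J none) (J (some a)) m * T s x (update (J ∘ some) a m))
      (chrDot G S b t x (J none) (J (some a)) m * T t x (update (J ∘ some) a m)
        + chrCoef (G t) b x (J none) (J (some a)) m * tder T S t x (update (J ∘ some) a m)) S t := by
    intro a m
    exact (hG.hasDerivWithinAt_chrCoef b hx ht (J none) (J (some a)) m).mul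
      (hT.hasDerivWithinAt hx ht (update (J ∘ some) a m))
  have h3 : HasDerivWithinAt
      (fun s ↦ ∑ a, ∑ m, chrCoef (G s) b x (J none) (J (some a)) m * T s x (update (J ∘ some) a m))
      (∑ a, ∑ m, (chrDot G S b t x (J none) (J (some a)) m * T t x (update (J ∘ some) a m)
        + chrCoef (G t) b x (J none) (J (some a)) m * tder T S t x (update (J ∘ some) a m))) S t :=
    HasDerivWithinAt.fun_sum fun a _ ↦ HasDerivWithinAt.fun_sum fun m _ ↦ h2 a m
  have h4 : HasDerivWithinAt (fun s ↦ fderiv ℝ (fun y ↦ T s y (J ∘ some)) x (b (J none))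
      - ∑ a, ∑ m, chrCoef (G s) b x (J none) (J (some a)) m * T s x (update (J ∘ some) a m))
      (fderiv ℝ (fun y ↦ tder T S t y (J ∘ some)) x (b (J none))
        - ∑ a, ∑ m, (chrDot G S b t x (J none) (J (some a)) m * T t x (update (J ∘ some) a m)
          + chrCoef (G t) b x (J none) (J (some a)) m * tder T S t x (update (J ∘ some) a m))) S t :=
    h1.sub h3
  have hfun : (fun s ↦ tcov (G s) b (T s) x J) = fun s ↦ fderiv ℝ (fun y ↦ T s y (J ∘ some)) x (b (J none))
      - ∑ a, ∑ m, chrCoef (G s) b x (J none) (J (some a)) m * T s x (update (J ∘ some) a m) := rfl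
  rw [hfun]
  refine h4.congr_deriv ?_
  simp only [tcov_apply, Finset.sum_add_distrib]
  ring

/-- The time derivative of the inverse metric coefficients within `S`. [folklore] -/
def ginvDot (G : ℝ → E → E →L[ℝ] E →L[ℝ] ℝ) (S : Set ℝ) (b : Basis ι ℝ E) (t : ℝ) (x : E) (j k : ι) : ℝ :=
  derivWithin (fun s ↦ ginv (G s) b x j k) S t

omit [Fintype ι] [Fintype α] [DecidableEq α] in
/-- `g^{jk}` of the family is differentiable in time with derivative `ginvDot`. [folklore] -/
theorem IsMetricFamilyOn.hasDerivWithinAt_ginv' (hG : IsMetricFamilyOn G S V) (hx : x ∈ V) (ht : t ∈ S) (j k : ι) :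
    HasDerivWithinAt (fun s ↦ ginv (G s) b x j k) (ginvDot G S b t x j k) S t := by
  rw [ginvDot, (hG.hasDerivWithinAt_ginv b hx ht j k).derivWithin (hG.uniqueDiffOn t ht)]
  exact hG.hasDerivWithinAt_ginv b hx ht j k

omit [Fintype α] [DecidableEq α] in
/-- **`∂_t (tr T)_I = Σ_{jk} ∂_tg^{jk} T_{jkI} + (tr ∂_tT)_I`.** [cite: Topping2006, §2.3] -/
theorem IsMetricFamilyOn.hasDerivWithinAt_ttr (hG : IsMetricFamilyOn G S V)
    {T : ℝ → E → (Option (Option α) → ι) → ℝ} (hT : TSmoothFamOn T V S) (hx : x ∈ V) (ht : t ∈ S)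
    (I : α → ι) :
    HasDerivWithinAt (fun s ↦ ttr (G s) b (T s) x I)
      (∑ j, ∑ k, ginvDot G S b t x j k * T t x (ocons j (ocons k I)) + ttr (G t) b (tder T S t) x I) S t := by
  have h : ∀ j k, HasDerivWithinAt (fun s ↦ ginv (G s) b x j k * T s x (ocons j (ocons k I)))
      (ginvDot G S b t x j k * T t x (ocons j (ocons k I))
        + ginv (G t) b x j k * tder T S t x (ocons j (ocons k I))) S t := by
    intro j k
    exact (hG.hasDerivWithinAt_ginv' b hx ht j k).mul (hT.hasDerivWithinAt hx ht (ocons j (ocons k I)))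
  have h2 := HasDerivWithinAt.fun_sum fun j (_ : j ∈ Finset.univ) ↦
    HasDerivWithinAt.fun_sum fun k (_ : k ∈ Finset.univ) ↦ h j k
  have hfun : (fun s ↦ ttr (G s) b (T s) x I) =
      fun s ↦ ∑ j, ∑ k, ginv (G s) b x j k * T s x (ocons j (ocons k I)) := rfl
  rw [hfun]
  refine h2.congr_deriv ?_
  simp only [ttr_apply, Finset.sum_add_distrib]

/-- **`∂_t ⟨S, T⟩ = Σ_{IJ} (∂_t Π_a g^{I_aJ_a}) S_I T_J + ⟨∂_tS, T⟩ + ⟨S, ∂_tT⟩`**, the derivative of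
the product being `Σ_a (Π_{a'≠a} g^{I_{a'}J_{a'}}) ∂_tg^{I_aJ_a}`. [cite: Topping2006, §2.3] -/
theorem IsMetricFamilyOn.hasDerivWithinAt_tinner (hG : IsMetricFamilyOn G S V)
    {T T' : ℝ → E → (α → ι) → ℝ} (hT : TSmoothFamOn T V S) (hT' : TSmoothFamOn T' V S) (hx : x ∈ V) (ht : t ∈ S) :
    HasDerivWithinAt (fun s ↦ tinner (G s) b (T s) (T' s) x)
      (∑ I : α → ι, ∑ J : α → ι, (∑ a, (∏ a' ∈ Finset.univ.erase a, ginv (G t) b x (I a') (J a')) *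
          ginvDot G S b t x (I a) (J a)) * (T t x I * T' t x J)
        + tinner (G t) b (tder T S t) (T' t) x + tinner (G t) b (T t) (tder T' S t) x) S t := by
  have hP : ∀ I J : α → ι, HasDerivWithinAt (fun s ↦ ∏ a, ginv (G s) b x (I a) (J a))
      (∑ a, (∏ a' ∈ Finset.univ.erase a, ginv (G t) b x (I a') (J a')) * ginvDot G S b t x (I a) (J a)) S t := by
    intro I J
    have h := HasDerivWithinAt.fun_finsetProd (u := Finset.univ)
      (fun a _ ↦ hG.hasDerivWithinAt_ginv' b hx ht (I a) (J a))
    simp only [smul_eq_mul] at h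
    exact h
  have h : ∀ I J : α → ι, HasDerivWithinAt (fun s ↦ (∏ a, ginv (G s) b x (I a) (J a)) * (T s x I * T' s x J))
      ((∑ a, (∏ a' ∈ Finset.univ.erase a, ginv (G t) b x (I a') (J a')) * ginvDot G S b t x (I a) (J a)) *
          (T t x I * T' t x J)
        + (∏ a, ginv (G t) b x (I a) (J a)) *
          (tder T S t x I * T' t x J + T t x I * tder T' S t x J)) S t := by
    intro I J
    exact (hP I J).mul ((hT.hasDerivWithinAt hx ht I).mul (hT'.hasDerivWithinAt hx ht J))
  have h2 := HasDerivWithinAt.fun_sum fun I (_ : I ∈ (Finset.univ : Finset (α → ι))) ↦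
    HasDerivWithinAt.fun_sum fun J (_ : J ∈ (Finset.univ : Finset (α → ι))) ↦ h I J
  have hfun : (fun s ↦ tinner (G s) b (T s) (T' s) x) =
      fun s ↦ ∑ I : α → ι, ∑ J : α → ι, (∏ a, ginv (G s) b x (I a) (J a)) * (T s x I * T' s x J) := rfl
  rw [hfun]
  refine h2.congr_deriv ?_
  simp only [tinner_apply, Finset.sum_add_distrib, mul_add]
  ring

end TimeDeriv

/-! ### The Ricci tensor and its derivative as component fields -/

section Ric2

variable [Fintype ι] {G : E → E →L[ℝ] E →L[ℝ] ℝ} (b : Basis ι ℝ E) {α : Type*} [Fintype α] [DecidableEq α]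
  {V : Set E} {x : E} [FiniteDimensional ℝ E]

/-- **The Ricci tensor acting on slot `a` of `T` (index of `T` raised)**:
`(ricSlot T a)_I = Σ_m (Σ_c g^{mc} Ric(b_c, b_{I_a})) T_{I[a ↦ m]}` — the terms produced by
`∂_t g^{ij} = 2R^{ij}` in `∂_t |T|²` (Topping 2006, proof of Prop. 3.2.10).
[cite: Topping2006, Prop. 3.2.10 (proof)] -/
def ricSlot (G : E → E →L[ℝ] E →L[ℝ] ℝ) (b : Basis ι ℝ E) (T : E → (α → ι) → ℝ) (a : α) :
    E → (α → ι) → ℝ :=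
  fun x I ↦ ∑ m, (∑ c, ginv G b x m c * ricAt G x (b c) (b (I a))) * T x (update I a m)

/-- The relabelling behind `ricSlot T a = tr ((Ric ⊗ T) ∘ e)`: forward map. [folklore] -/
def slotEquivFun (a : α) : Fin 2 ⊕ α → Option (Option α)
  | Sum.inl i => ![some none, some (some a)] i
  | Sum.inr a' => if a' = a then none else some (some a')

/-- The relabelling behind `ricSlot T a = tr ((Ric ⊗ T) ∘ e)`: inverse map. [folklore] -/
def slotEquivInv (a : α) : Option (Option α) → Fin 2 ⊕ α
  | none => Sum.inr a
  | some none => Sum.inl 0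
  | some (some a') => if a' = a then Sum.inl 1 else Sum.inr a'

omit [Fintype α] in
/-- **The relabelling `Fin 2 ⊕ α ≃ Option (Option α)`** for `ricSlot`. [folklore] -/
def slotEquiv (a : α) : Fin 2 ⊕ α ≃ Option (Option α) where
  toFun := slotEquivFun a
  invFun := slotEquivInv a
  left_inv := by
    rintro (i | a')
    · fin_cases i <;> simp [slotEquivFun, slotEquivInv]
    · by_cases h : a' = a
      · subst h; simp [slotEquivFun, slotEquivInv]
      · simp [slotEquivFun, slotEquivInv, h]
  right_inv := by
    rintro (_ | _ | a')
    · simp [slotEquivFun, slotEquivInv]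
    · simp [slotEquivFun, slotEquivInv]
    · by_cases h : a' = a
      · subst h; simp [slotEquivFun, slotEquivInv]
      · simp [slotEquivFun, slotEquivInv, h]

omit [Fintype ι] [Fintype α] [FiniteDimensional ℝ E] in
/-- The slots under `slotEquiv a`. [folklore] -/
theorem ocons₂_comp_slotEquiv (a : α) (p q : ι) (I : α → ι) :
    (ocons p (ocons q I) ∘ slotEquiv a) ∘ Sum.inl = ![q, I a] ∧
      (ocons p (ocons q I) ∘ slotEquiv a) ∘ Sum.inr = update I a p := by
  constructor
  · funext i; fin_cases i <;> rfl
  · funext a'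
    by_cases h : a' = a
    · subst h; simp [slotEquiv, slotEquivFun]
    · rw [update_of_ne h]; simp [slotEquiv, slotEquivFun, h]

omit [Fintype α] in
/-- **`ricSlot T a` is the double trace of the relabelled product `Ric ⊗ T`** (componentwise).
[cite: Topping2006, Prop. 3.2.10 (proof)] -/
theorem ricSlot_eq_ttr (T : E → (α → ι) → ℝ) (a : α) (x : E) (I : α → ι) :
    ricSlot G b T a x I = ttr G b (treindex (slotEquiv a) (tprod (ric2 G b) T)) x I := by
  rw [ttr_apply]
  simp only [ricSlot, treindex_apply, tprod_apply, (ocons₂_comp_slotEquiv a _ _ I).1,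
    (ocons₂_comp_slotEquiv a _ _ I).2, Finset.sum_mul]
  refine Finset.sum_congr rfl fun m _ ↦ Finset.sum_congr rfl fun c _ ↦ ?_
  simp only [ric2, Matrix.cons_val_zero, Matrix.cons_val_one]
  ring

/-- The relabelling `Fin 4 ≃ Option (Option (Fin 2))` presenting `Ric` as a trace of `Rm`
(`Ric(Y,Z) = Σ g^{ij} R(b_i,Y,Z,b_j)`). [folklore] -/
def ricTraceEquiv : Fin 4 ≃ Option (Option (Fin 2)) :=
  Equiv.ofBijective ![none, some (some 0), some (some 1), some none] (by decide)

omit [Fintype α] [DecidableEq α] in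
/-- **`Ric` is the trace of `Rm`**: `ric2 = tr (rm4 ∘ ricTraceEquiv)` at points where `G x` is
invertible (`ricAt_eq_sum_ginv`). [cite: ONeill1983, Ch. 3, Lemma 3.52] -/
theorem ric2_eq_ttr (hx : (G x).IsInvertible) (J : Fin 2 → ι) :
    ric2 G b x J = ttr G b (treindex ricTraceEquiv (rm4 G b)) x J := by
  rw [ric2, ricAt_eq_sum_ginv b hx, ttr_apply]
  refine Finset.sum_congr rfl fun i _ ↦ Finset.sum_congr rfl fun j _ ↦ ?_
  rw [treindex_apply]
  have h : ocons i (ocons j J) ∘ ricTraceEquiv = ![i, J 0, J 1, j] := by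
    funext k; fin_cases k <;> rfl
  rw [h, rm4_vec]

omit [Fintype α] [DecidableEq α] in
/-- **`∇Ric` in the component calculus is `cov₂At Ric`**: `(∇ ric2)_{j,(i,l)} = (∇_{b_j} Ric)(b_i, b_l)`.
[cite: ONeill1983, Ch. 2, Prop. 2.13] -/
theorem IsMetricOn.tcov_ric2 [CompleteSpace E] (hG : IsMetricOn G V) (hx : x ∈ V) (j i l : ι) :
    tcov G b (ric2 G b) x (ocons j ![i, l]) = cov₂At G (ricAt G) x (b j) (b i) (b l) := by
  have hRd : DifferentiableAt ℝ (ricAt G) x := (hG.contDiffOn_ricAt.contDiffAt (hG.isOpen.mem_nhds hx)).differentiableAt (by simp)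
  rw [tcov_apply_ocons, cov₂At_apply, Fin.sum_univ_two]
  simp only [ric2, Matrix.cons_val_zero, Matrix.cons_val_one]
  have h1 : fderiv ℝ (fun y ↦ ricAt G y (b i) (b l)) x (b j) = fderiv ℝ (ricAt G) x (b j) (b i) (b l) := by
    rw [fderiv_clm_apply_const (differentiableAt_clm_apply_const hRd (b i)) (b l) (b j),
      fderiv_clm_apply_const hRd (b i) (b j)]
  have h2 : ∀ m, (update ![i, l] 0 m : Fin 2 → ι) = ![m, l] := fun m ↦ by
    funext k; fin_cases k <;> rfl
  have h3 : ∀ m, (update ![i, l] 1 m : Fin 2 → ι) = ![i, m] := fun m ↦ by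
    funext k; fin_cases k <;> rfl
  simp only [h1, h2, h3, Matrix.cons_val_zero, Matrix.cons_val_one]
  rw [chrAt_basis_eq_sum b x j i, chrAt_basis_eq_sum b x j l, map_sum, map_sum, _root_.sum_apply]
  simp only [map_smul, _root_.smul_apply, smul_eq_mul]
  ring

end Ric2

/-! ### Under the Ricci flow -/

namespace IsMetricFamilyOn

section RicciFlow

variable [Fintype ι] {G : ℝ → E → E →L[ℝ] E →L[ℝ] ℝ} {S : Set ℝ} {V : Set E} {x : E} {t : ℝ}
  (b : Basis ι ℝ E) {α : Type*} [Fintype α] [DecidableEq α] [FiniteDimensional ℝ E] [CompleteSpace E]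
  (hG : IsMetricFamilyOn G S V)
  (hfl : ∀ s ∈ S, ∀ y ∈ V, tDeriv G S s y = (-2 : ℝ) • ricAt (G s) y)
include hG hfl

omit [Fintype α] [DecidableEq α] in
/-- `∂_t g^{jk} = 2 Σ_{cd} g^{jc} Ric(b_c,b_d) g^{dk}` under the flow (as a value of `ginvDot`).
[cite: Topping2006, Prop. 3.2.10 (proof)] -/
theorem ginvDot_ricciFlow (hx : x ∈ V) (ht : t ∈ S) (j k : ι) :
    ginvDot G S b t x j k = 2 * ∑ c, ∑ d, ginv (G t) b x j c * ricAt (G t) x (b c) (b d) * ginv (G t) b x d k :=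
  (hG.hasDerivWithinAt_ginv_ricciFlow b hfl hx ht j k).derivWithin (hG.uniqueDiffOn t ht)

omit [Fintype α] [DecidableEq α] in
/-- **`∂_t Γ` under the flow in components**:
`∂_tΓ^m_{ji} = −Σ_l g^{ml} [(∇_jRic)(b_i,b_l) + (∇_iRic)(b_j,b_l) − (∇_lRic)(b_j,b_i)]`
(Topping, Prop. 2.3.1 with `h = −2 Ric`). [cite: Topping2006, Prop. 2.3.1] -/
theorem chrDot_ricciFlow (hx : x ∈ V) (ht : t ∈ S) (j i m : ι) :
    chrDot G S b t x j i m = -∑ l, ginv (G t) b x m l *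
      (tcov (G t) b (ric2 (G t) b) x (ocons j ![i, l]) + tcov (G t) b (ric2 (G t) b) x (ocons i ![j, l])
        - tcov (G t) b (ric2 (G t) b) x (ocons l ![j, i])) := by
  have hGt := hG.isMetricOn t ht
  rw [chrDot, coord_eq_sum_ginv b (hGt.isInvertible x hx), ← Finset.sum_neg_distrib]
  refine Finset.sum_congr rfl fun l _ ↦ ?_
  rw [hG.apply_varChrAt_of_flow hfl ht hx, hGt.tcov_ric2 b hx, hGt.tcov_ric2 b hx, hGt.tcov_ric2 b hx]
  ring

variable {T : ℝ → E → (α → ι) → ℝ}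

/-- **`∂_t |T|² = 2⟨∂_t T, T⟩ + 2 Σ_a ⟨ricSlot_a T, T⟩` under the Ricci flow** (Topping 2006,
proof of Prop. 3.2.10, first step: `∂_t(g^{ij}g^{kl}… T T) = 2(R^{ij}g^{kl}… + …) T T + 2⟨T, ∂_tT⟩`,
here for covariant tensor fields of any rank). [cite: Topping2006, Prop. 3.2.10 (proof)] -/
theorem hasDerivWithinAt_tnormSq_ricciFlow (hT : TSmoothFamOn T V S) (hx : x ∈ V) (ht : t ∈ S) :
    HasDerivWithinAt (fun s ↦ tnormSq (G s) b (T s) x)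
      (2 * tinner (G t) b (tder T S t) (T t) x
        + 2 * ∑ a, tinner (G t) b (ricSlot (G t) b (T t) a) (T t) x) S t := by
  have hGt := hG.isMetricOn t ht
  have hi := hGt.isInvertible x hx
  have hgs : ∀ p q, ginv (G t) b x p q = ginv (G t) b x q p := fun p q ↦ ginv_comm b hi (hGt.symm x hx) p q
  have h := hG.hasDerivWithinAt_tinner b hT hT hx ht
  refine (h.congr_deriv ?_)
  -- the `∂_t g` term
  have hdot : ∀ i k, ginvDot G S b t x i k =
      2 * ∑ d, (∑ c, ginv (G t) b x i c * ricAt (G t) x (b c) (b d)) * ginv (G t) b x d k := by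
    intro i k
    rw [hG.ginvDot_ricciFlow b hfl hx ht, Finset.sum_comm]
    congr 1
    refine Finset.sum_congr rfl fun d _ ↦ ?_
    rw [Finset.sum_mul]
  have hstep : ∀ a, ∑ I : α → ι, ∑ J : α → ι, (∏ a' ∈ Finset.univ.erase a, ginv (G t) b x (I a') (J a')) *
      (∑ d, (∑ c, ginv (G t) b x (I a) c * ricAt (G t) x (b c) (b d)) * ginv (G t) b x d (J a)) *
        (T t x I * T t x J) = tinner (G t) b (ricSlot (G t) b (T t) a) (T t) x := by
    intro a
    rw [sum_prod_erase_mul_left (ginv (G t) b x)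
      (fun d i ↦ ∑ c, ginv (G t) b x i c * ricAt (G t) x (b c) (b d)) a (T t x) (T t x), tinner_apply]
    rfl
  have hkey : ∑ I : α → ι, ∑ J : α → ι, (∑ a, (∏ a' ∈ Finset.univ.erase a, ginv (G t) b x (I a') (J a')) *
      ginvDot G S b t x (I a) (J a)) * (T t x I * T t x J) =
      2 * ∑ a, tinner (G t) b (ricSlot (G t) b (T t) a) (T t) x := by
    calc ∑ I : α → ι, ∑ J : α → ι, (∑ a, (∏ a' ∈ Finset.univ.erase a, ginv (G t) b x (I a') (J a')) *
          ginvDot G S b t x (I a) (J a)) * (T t x I * T t x J)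
        = ∑ I : α → ι, ∑ J : α → ι, ∑ a, (∏ a' ∈ Finset.univ.erase a, ginv (G t) b x (I a') (J a')) *
            ginvDot G S b t x (I a) (J a) * (T t x I * T t x J) := by
          simp only [Finset.sum_mul]
      _ = ∑ a, ∑ I : α → ι, ∑ J : α → ι, (∏ a' ∈ Finset.univ.erase a, ginv (G t) b x (I a') (J a')) *
            ginvDot G S b t x (I a) (J a) * (T t x I * T t x J) := sum_comm₃' _
      _ = ∑ a, 2 * ∑ I : α → ι, ∑ J : α → ι, (∏ a' ∈ Finset.univ.erase a, ginv (G t) b x (I a') (J a')) *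
            (∑ d, (∑ c, ginv (G t) b x (I a) c * ricAt (G t) x (b c) (b d)) * ginv (G t) b x d (J a)) *
              (T t x I * T t x J) := by
          refine Finset.sum_congr rfl fun a _ ↦ ?_
          rw [Finset.mul_sum]
          refine Finset.sum_congr rfl fun I _ ↦ ?_
          rw [Finset.mul_sum]
          refine Finset.sum_congr rfl fun J _ ↦ ?_
          rw [hdot]
          ring
      _ = 2 * ∑ a, tinner (G t) b (ricSlot (G t) b (T t) a) (T t) x := by
          rw [Finset.mul_sum]
          exact Finset.sum_congr rfl fun a _ ↦ by rw [hstep]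
  rw [hkey, tinner_comm hgs (T t) (tder T S t)]
  ring

end RicciFlow

end IsMetricFamilyOn

end MetricCoord

end Literature.Geometry.Lorentzian

end
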